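import Literature.NumberTheory.Automorphic.BianchiMaassCuspForms
import Literature.LinearAlgebra.Matrix.GLPathConnected
import HarnessLib

/-!
# Iwasawa coordinates of `GL₂(ℂ)` over hyperbolic `3`-space, with their first-order calculus

Topic `NumberTheory/Automorphic`; namespace `Literature.NumberTheory.Automorphic`, grouping
sub-namespace `GL2C` (calculus on the real manifold `GL₂(ℂ) ⊆ M₂(ℂ)`, an open subset of the real
normed space `M₂(ℂ)` with the tree's `L^∞`-operator norm `Matrix.Norms.Operator`).  Definitions
with bodies and theorems; no named facts.  This is the coordinate bookkeeping behind the degree-one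
Eichler–Shimura–Harder map for `GL₂` over an imaginary quadratic field (primitives on
`GL₂(ℂ)/ℂˣU(2) = ℍ³` of closed `U(2)`-equivariant `1`-cochains; sequel file
`GL2CEquivariantPrimitive`), phrased for functions on ALL of `M₂(ℂ)` restricted to the open set
`GL2C.Inv = {M | IsUnit (det M)}` so that Mathlib's Fréchet calculus applies verbatim.

* `GL2C.proj : M₂(ℂ) → ℂ × ℝ` — the orbit map `M ↦ M • j` onto the tree's upper half-space
  `ℍ³ = {(z, r) : r > 0}` (`UpperHalfSpace`, base point `j = (0, 1)`; junk `j` off `Inv`):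
  `proj M = ((M₀₁ M̄₁₁ + M₀₀ M̄₁₀) / (|M₁₁|² + |M₁₀|²), |det M| / (|M₁₁|² + |M₁₀|²))`
  (`proj_eq`; the tree's `UpperHalfSpace.smul_z`, `smul_r`), i.e. `(Q₀₁ / Q₁₁, |det M| / Q₁₁)`
  for `Q = M Mᴴ` [cite: ElstrodtGrunewaldMennicke1998, Ch. 1 §1.1 and §1.3]; it is
  multiplicative (`proj_mul`), right-invariant under `U(2)` and under the centre `ℂˣ`
  (`proj_mul_of_mem_unitaryGroup`, `proj_smul`), and smooth on `Inv` (`contDiffOn_proj`).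
* `GL2C.sec : ℂ × ℝ → M₂(ℂ)` — the Iwasawa section `(z, r) ↦ n_z a_r = (√r, z/√r; 0, 1/√r)`
  [cite: ElstrodtGrunewaldMennicke1998, Ch. 1 §1.1] [cite: Garrett2018, §1.3 and §1.6]:
  `det = 1`, `proj (sec p) = p` (`proj_sec`), upper triangular matrices act affinely
  `proj (sec p * N) = (r • (proj N).1 + z, r * (proj N).2)` (`proj_sec_mul`), smooth on the
  half-space with derivative `D sec(p) v = sec p * Z_p(v)`,
  `Z_p(v) = (2r)⁻¹ (X(v) + Y(v))` (`hasFDerivAt_sec`), where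
* `GL2C.Xof v = (v_r, v_z; v̄_z, −v_r)` parametrises the traceless Hermitian matrices
  `𝔭₀ ≅ T_j ℍ³ = ℂ × ℝ` (inverse `GL2C.vof X = (X₀₁, Re X₀₀)` on `𝔭₀`, `Xof_vof`) and
  `GL2C.Yof v = (0, v_z; −v̄_z, 0) ∈ 𝔲(2)` is the compensating infinitesimal rotation;
* **Iwasawa decomposition** `exists_eq_sec_mul_smul`: every `M ∈ Inv` is `sec (proj M) * (c • k)`
  with `c = |det M|^{1/2} > 0` and `k ∈ U(2)` (`M Mᴴ = |det M| · sec sec ᴴ`, a `2 × 2` identity);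
* **the differential of the orbit map at `1`**: `hasDerivAt_proj_one_add_smul` —
  `d/dt proj (1 + tX)|₀ = (X₀₁ + X̄₁₀, Re X₀₀ − Re X₁₁)`, which is `2 · vof X` on `𝔭₀` and
  vanishes on `𝔲(2) ⊕ ℝ·1` (`T_1 (GL₂(ℂ)/ℂˣU(2)) = 𝔤 / (𝔨 ⊕ 𝔞_G) ≅ 𝔭₀`).
* `GL2C.isOpen_Inv`, `GL2C.isPreconnected_Inv` (from the tree's `isPathConnected_isUnit_det`) and
  `GL2C.eqOn_const_of_fderiv_eq_zero` — a function differentiable on `GL₂(ℂ)` all of whose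
  directional derivatives `DF(M)(M X)` vanish is constant there (the connectedness input of the
  van Est map: "`d(γ•F − F) = 0` ⇒ `γ•F − F` is a constant").

## References

* J. Elstrodt, F. Grunewald, J. Mennicke, *Groups Acting on Hyperbolic Space*, Springer 1998,
  Ch. 1 §1.1 (upper half-space, action of `GL₂(ℂ)`), §1.3. [ElstrodtGrunewaldMennicke1998]
* P. Garrett, *Modern Analysis of Automorphic Forms by Example*, vol. 1, CUP 2018, §1.3
  (`ℍ³ = SL₂(ℂ)/SU(2)`, Iwasawa coordinates `n_z a_r`), §1.6. [Garrett2018]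
-/

noncomputable section

open Matrix Complex Set Filter
open scoped MatrixGroups ComplexConjugate Matrix.Norms.Operator Topology ContDiff Classical

namespace Literature.NumberTheory.Automorphic

namespace GL2C

/-- `M₂(ℂ)` (the tree's `BianchiCone.Mat`). [folklore] -/
abbrev Mat : Type := Matrix (Fin 2) (Fin 2) ℂ

/-! ### The open set of invertible matrices -/

/-- `GL₂(ℂ) ⊆ M₂(ℂ)` as the open set of matrices with invertible determinant. [folklore] -/
def Inv : Set Mat := {M | IsUnit M.det}

/-- Membership in `Inv`. [folklore] -/
@[simp] theorem mem_Inv {M : Mat} : M ∈ Inv ↔ IsUnit M.det := Iff.rfl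

/-- `Inv` is open (preimage of the units of `ℂ` under the continuous determinant). [folklore] -/
theorem isOpen_Inv : IsOpen Inv := by
  have h : Inv = (fun M : Mat => M.det) ⁻¹' {z : ℂ | z ≠ 0} := by
    ext M; simp [Inv, isUnit_iff_ne_zero]
  rw [h]
  exact isOpen_ne.preimage (continuous_id.matrix_det)

/-- `Inv` is preconnected (`GL₂(ℂ)` is path connected, `isPathConnected_isUnit_det`). [folklore] -/
theorem isPreconnected_Inv : IsPreconnected Inv :=
  (Literature.LinearAlgebra.Matrix.isPathConnected_isUnit_det (n := Fin 2)).isConnected.isPreconnected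

/-- `Inv` is closed under multiplication. [folklore] -/
theorem mul_mem_Inv {M N : Mat} (hM : M ∈ Inv) (hN : N ∈ Inv) : M * N ∈ Inv := by
  rw [mem_Inv, det_mul]; exact hM.mul hN

/-- `1 ∈ Inv`. [folklore] -/
theorem one_mem_Inv : (1 : Mat) ∈ Inv := by simp [Inv]

/-- Non-zero scalar multiples of elements of `Inv` lie in `Inv`. [folklore] -/
theorem smul_mem_Inv {M : Mat} (hM : M ∈ Inv) {c : ℂ} (hc : c ≠ 0) : c • M ∈ Inv := by
  rw [mem_Inv, det_smul, Fintype.card_fin]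
  exact (IsUnit.pow 2 (isUnit_iff_ne_zero.2 hc)).mul hM

/-- Unitary matrices lie in `Inv`. [folklore] -/
theorem mem_Inv_of_mem_unitaryGroup {k : Mat} (hk : k ∈ Matrix.unitaryGroup (Fin 2) ℂ) : k ∈ Inv :=
  (Matrix.UnitaryGroup.det_isUnit ⟨k, hk⟩ :)

/-- **Vanishing directional derivatives along `M X` force constancy on `GL₂(ℂ)`**: if `F` is
differentiable on `Inv` and `DF(M)(M X) = 0` for all `M ∈ Inv` and all `X ∈ M₂(ℂ)`, then `F` is
constant on `Inv` (`M X` runs over all of `M₂(ℂ)` as `X` does, so `DF = 0` on the open connected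
`Inv`; Mathlib `IsOpen.is_const_of_fderiv_eq_zero`). [folklore] -/
theorem eqOn_const_of_fderiv_eq_zero {V : Type*} [NormedAddCommGroup V] [NormedSpace ℝ V]
    {F : Mat → V} (hF : DifferentiableOn ℝ F Inv)
    (h : ∀ M ∈ Inv, ∀ X : Mat, fderiv ℝ F M (M * X) = 0) {M N : Mat} (hM : M ∈ Inv) (hN : N ∈ Inv) :
    F M = F N := by
  refine isOpen_Inv.is_const_of_fderiv_eq_zero isPreconnected_Inv hF (fun A hA => ?_) hM hN
  ext Y
  have hAu : IsUnit A := (Matrix.isUnit_iff_isUnit_det A).2 hA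
  obtain ⟨u, rfl⟩ := hAu
  have := h (u : Mat) hA ((u⁻¹ : (Mat)ˣ) * Y)
  rwa [← Matrix.mul_assoc, Units.mul_inv, Matrix.one_mul] at this

/-! ### The orbit map onto `ℍ³` -/

open UpperHalfSpace

/-- **The orbit map `M ↦ M • j`** of `GL₂(ℂ)` on hyperbolic `3`-space through the base point
`j = (0, 1)`, read in `ℂ × ℝ ⊇ ℍ³` (the tree's action `UpperHalfSpace.instMulAction`; junk
value `j` off `Inv`). [cite: ElstrodtGrunewaldMennicke1998, Ch. 1 §1.1] -/
def proj (M : Mat) : ℂ × ℝ :=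
  if h : IsUnit M.det then
    ((Matrix.GeneralLinearGroup.mk'' M h • (default : ℍ³) : ℍ³) : ℂ × ℝ)
  else ((0 : ℂ), (1 : ℝ))

/-- Unfolding `proj` on `Inv`. [folklore] -/
theorem proj_of_isUnit {M : Mat} (h : IsUnit M.det) :
    proj M = ((Matrix.GeneralLinearGroup.mk'' M h • (default : ℍ³) : ℍ³) : ℂ × ℝ) := by
  rw [proj, dif_pos h]

/-- `proj g = g • j` for `g ∈ GL₂(ℂ)`. [folklore] -/
theorem proj_coe (g : GL (Fin 2) ℂ) :
    proj (g : Mat) = ((g • (default : ℍ³) : ℍ³) : ℂ × ℝ) := by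
  have h : IsUnit (g : Mat).det := (g.isUnit.map Matrix.detMonoidHom :)
  rw [proj_of_isUnit h]
  congr 2
  ext i j
  simp

/-- `proj` lands in the open half-space `{r > 0}`. [folklore] -/
theorem proj_snd_pos (M : Mat) : 0 < (proj M).2 := by
  by_cases h : IsUnit M.det
  · rw [proj_of_isUnit h]; exact UpperHalfSpace.r_pos _
  · rw [proj, dif_neg h]; exact one_pos

/-- The denominator `|M₁₁|² + |M₁₀|²` is positive on `Inv`. [folklore] -/
theorem denom_pos {M : Mat} (h : IsUnit M.det) : 0 < normSq (M 1 1) + normSq (M 1 0) := by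
  by_contra hle
  push Not at hle
  have h1 : normSq (M 1 1) = 0 := le_antisymm
    (by nlinarith [normSq_nonneg (M 1 1), normSq_nonneg (M 1 0)]) (normSq_nonneg _)
  have h0 : normSq (M 1 0) = 0 := le_antisymm
    (by nlinarith [normSq_nonneg (M 1 1), normSq_nonneg (M 1 0)]) (normSq_nonneg _)
  rw [normSq_eq_zero] at h1 h0
  apply h.ne_zero
  rw [det_fin_two, h1, h0, mul_zero, mul_zero, sub_zero]

/-- **The explicit formula** `proj M = ((M₀₁ M̄₁₁ + M₀₀ M̄₁₀) / (|M₁₁|² + |M₁₀|²),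
|det M| / (|M₁₁|² + |M₁₀|²))` on `Inv` (the tree's `smul_z`, `smul_r` at `j`).
[cite: ElstrodtGrunewaldMennicke1998, Ch. 1 §1.1] -/
theorem proj_eq {M : Mat} (h : IsUnit M.det) :
    proj M = ((M 0 1 * conj (M 1 1) + M 0 0 * conj (M 1 0)) /
        ((normSq (M 1 1) : ℂ) + (normSq (M 1 0) : ℂ)),
      ‖M.det‖ / (normSq (M 1 1) + normSq (M 1 0))) := by
  rw [proj_of_isUnit h]
  set g := Matrix.GeneralLinearGroup.mk'' M h with hg
  have hgM : ∀ i j, g i j = M i j := fun i j => by simp [hg]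
  have hdet : (g : Mat).det = M.det := congrArg Matrix.det (Matrix.ext hgM)
  refine Prod.ext ?_ ?_
  · change (g • (default : ℍ³)).z = _
    rw [smul_z]
    simp only [z_default, r_default, mul_zero, zero_add, hgM, ofReal_one, one_pow, mul_one]
    push_cast
    ring
  · change (g • (default : ℍ³)).r = _
    rw [smul_r]
    simp only [z_default, r_default, mul_zero, zero_add, hgM, one_pow, mul_one, hdet]

/-- **`proj` is multiplicative**: `proj (M N) = M • proj N` for `M, N ∈ Inv` (`GL₂(ℂ)` ACTS on
`ℍ³`, the tree's `mul_smul`). [cite: ElstrodtGrunewaldMennicke1998, Ch. 1 §1.1] -/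
theorem proj_mul {M N : Mat} (hM : IsUnit M.det) (hN : IsUnit N.det) :
    proj (M * N) = ((Matrix.GeneralLinearGroup.mk'' M hM •
      (Matrix.GeneralLinearGroup.mk'' N hN • (default : ℍ³)) : ℍ³) : ℂ × ℝ) := by
  have hMN : IsUnit (M * N).det := by rw [det_mul]; exact hM.mul hN
  rw [proj_of_isUnit hMN, ← mul_smul]
  congr 2
  ext i j
  simp

/-- **`U(2)` fixes the base point**: `k • j = j` for unitary `k` (`k kᴴ = 1`: `Q₀₁ = 0`,
`Q₁₁ = 1`, `|det k| = 1`). [cite: Garrett2018, §1.3] -/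
theorem proj_of_mem_unitaryGroup {k : Mat} (hk : k ∈ Matrix.unitaryGroup (Fin 2) ℂ) :
    proj k = ((0 : ℂ), (1 : ℝ)) := by
  have hku : IsUnit k.det := mem_Inv_of_mem_unitaryGroup hk
  have hkk : k * star k = 1 := Matrix.mem_unitaryGroup_iff.1 hk
  have h01 : k 0 0 * conj (k 1 0) + k 0 1 * conj (k 1 1) = 0 := by
    have := congr_fun (congr_fun hkk 0) 1
    simpa [Matrix.mul_apply, Fin.sum_univ_two, Matrix.star_apply] using this
  have h11 : (normSq (k 1 1) : ℂ) + normSq (k 1 0) = 1 := by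
    have := congr_fun (congr_fun hkk 1) 1
    simp only [Matrix.mul_apply, Fin.sum_univ_two, Matrix.star_apply, Matrix.one_apply_eq,
      RCLike.star_def] at this
    rw [normSq_eq_conj_mul_self, normSq_eq_conj_mul_self, ← this]; ring
  have h11' : normSq (k 1 1) + normSq (k 1 0) = 1 := by exact_mod_cast h11
  have hdet : ‖k.det‖ = 1 := by
    have := Matrix.UnitaryGroup.det_isUnit ⟨k, hk⟩
    exact CStarRing.norm_of_mem_unitary (Matrix.det_of_mem_unitary hk)
  rw [proj_eq hku, hdet, h11']
  refine Prod.ext ?_ (by simp)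
  change (k 0 1 * conj (k 1 1) + k 0 0 * conj (k 1 0)) / ((normSq (k 1 1) : ℂ) + normSq (k 1 0)) = 0
  rw [h11, div_one, add_comm]
  exact h01

/-- **Right `U(2)`-invariance**: `proj (M k) = proj M` for `M ∈ Inv`, `k` unitary.
[cite: Garrett2018, §1.3] -/
theorem proj_mul_of_mem_unitaryGroup {M k : Mat} (hM : IsUnit M.det)
    (hk : k ∈ Matrix.unitaryGroup (Fin 2) ℂ) : proj (M * k) = proj M := by
  have hku : IsUnit k.det := mem_Inv_of_mem_unitaryGroup hk
  rw [proj_mul hM hku, proj_of_isUnit hM]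
  congr 2
  apply Subtype.ext
  have := proj_of_mem_unitaryGroup hk
  rw [proj_of_isUnit hku] at this
  exact this

/-- **The centre acts trivially**: `proj (c • M) = proj M` for `c ≠ 0`, `M ∈ Inv`.
[cite: ElstrodtGrunewaldMennicke1998, Ch. 1 §1.1] -/
theorem proj_smul {M : Mat} (hM : IsUnit M.det) {c : ℂ} (hc : c ≠ 0) :
    proj (c • M) = proj M := by
  have hcM : IsUnit (c • M).det := smul_mem_Inv hM hc
  rw [proj_eq hcM, proj_eq hM]
  have hD := denom_pos hM
  have hD' : ((normSq (M 1 1) : ℂ) + normSq (M 1 0)) ≠ 0 := by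
    rw [← ofReal_add]; exact ofReal_ne_zero.2 hD.ne'
  have hc2 : 0 < normSq c := normSq_pos.2 hc
  refine Prod.ext ?_ ?_
  · simp only [Matrix.smul_apply, smul_eq_mul, map_mul]
    have hL : ((normSq c * normSq (M 1 1) : ℝ) : ℂ) + ((normSq c * normSq (M 1 0) : ℝ) : ℂ) ≠ 0 := by
      rw [← ofReal_add, ← mul_add]; exact ofReal_ne_zero.2 (mul_pos hc2 hD).ne'
    rw [div_eq_div_iff hL hD']
    push_cast
    rw [normSq_eq_conj_mul_self (z := c)]
    ring
  · simp only [Matrix.smul_apply, smul_eq_mul, det_smul, Fintype.card_fin, norm_mul, norm_pow,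
      map_mul]
    rw [← normSq_eq_norm_sq, ← mul_add]
    field_simp

/-! ### Traceless Hermitian directions and infinitesimal rotations -/

/-- **The traceless Hermitian matrix of a tangent vector** `v = (v_z, v_r) ∈ ℂ × ℝ ≅ T_j ℍ³`:
`X(v) = (v_r, v_z; v̄_z, −v_r) ∈ 𝔭₀`. [cite: Garrett2018, §1.6] -/
def Xof (v : ℂ × ℝ) : Mat := !![(v.2 : ℂ), v.1; conj v.1, -(v.2 : ℂ)]

/-- **The infinitesimal rotation of a tangent vector**: `Y(v) = (0, v_z; −v̄_z, 0) ∈ 𝔲(2)`, the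
`𝔨`-component of the Iwasawa frame `sec⁻¹ D sec`. [cite: Garrett2018, §1.6] -/
def Yof (v : ℂ × ℝ) : Mat := !![0, v.1; -conj v.1, 0]

/-- **Reading the tangent vector off a traceless Hermitian matrix**: `vof X = (X₀₁, Re X₀₀)`.
[cite: Garrett2018, §1.6] -/
def vof (X : Mat) : ℂ × ℝ := (X 0 1, (X 0 0).re)

/-- Entry `(0,0)` of `Xof`. [folklore] -/
@[simp] theorem Xof_apply_00 (v : ℂ × ℝ) : Xof v 0 0 = v.2 := rfl
/-- Entry `(0,1)` of `Xof`. [folklore] -/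
@[simp] theorem Xof_apply_01 (v : ℂ × ℝ) : Xof v 0 1 = v.1 := rfl
/-- Entry `(1,0)` of `Xof`. [folklore] -/
@[simp] theorem Xof_apply_10 (v : ℂ × ℝ) : Xof v 1 0 = conj v.1 := rfl
/-- Entry `(1,1)` of `Xof`. [folklore] -/
@[simp] theorem Xof_apply_11 (v : ℂ × ℝ) : Xof v 1 1 = -(v.2 : ℂ) := rfl
/-- Entry `(0,0)` of `Yof`. [folklore] -/
@[simp] theorem Yof_apply_00 (v : ℂ × ℝ) : Yof v 0 0 = 0 := rfl
/-- Entry `(0,1)` of `Yof`. [folklore] -/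
@[simp] theorem Yof_apply_01 (v : ℂ × ℝ) : Yof v 0 1 = v.1 := rfl
/-- Entry `(1,0)` of `Yof`. [folklore] -/
@[simp] theorem Yof_apply_10 (v : ℂ × ℝ) : Yof v 1 0 = -conj v.1 := rfl
/-- Entry `(1,1)` of `Yof`. [folklore] -/
@[simp] theorem Yof_apply_11 (v : ℂ × ℝ) : Yof v 1 1 = 0 := rfl
/-- First component of `vof`. [folklore] -/
@[simp] theorem vof_fst (X : Mat) : (vof X).1 = X 0 1 := rfl
/-- Second component of `vof`. [folklore] -/
@[simp] theorem vof_snd (X : Mat) : (vof X).2 = (X 0 0).re := rfl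

/-- `Xof` is real-linear: additive. [folklore] -/
theorem Xof_add (v w : ℂ × ℝ) : Xof (v + w) = Xof v + Xof w := by
  ext i j; fin_cases i <;> fin_cases j <;> simp [Xof] ; ring

/-- `Xof` is real-linear: homogeneous. [folklore] -/
theorem Xof_smul (a : ℝ) (v : ℂ × ℝ) : Xof (a • v) = a • Xof v := by
  ext i j; fin_cases i <;> fin_cases j <;> simp [Xof, Complex.real_smul]

/-- `Yof` is real-linear: additive. [folklore] -/
theorem Yof_add (v w : ℂ × ℝ) : Yof (v + w) = Yof v + Yof w := by
  ext i j; fin_cases i <;> fin_cases j <;> simp [Yof] ; ring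

/-- `Yof` is real-linear: homogeneous. [folklore] -/
theorem Yof_smul (a : ℝ) (v : ℂ × ℝ) : Yof (a • v) = a • Yof v := by
  ext i j; fin_cases i <;> fin_cases j <;> simp [Yof, Complex.real_smul]

/-- `Xof` as a continuous real-linear map. [folklore] -/
def XofCLM : ℂ × ℝ →L[ℝ] Mat :=
  LinearMap.toContinuousLinearMap
    { toFun := Xof, map_add' := Xof_add, map_smul' := Xof_smul }

/-- `XofCLM v = Xof v`. [folklore] -/
@[simp] theorem XofCLM_apply (v : ℂ × ℝ) : XofCLM v = Xof v := rfl

/-- `Yof` as a continuous real-linear map. [folklore] -/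
def YofCLM : ℂ × ℝ →L[ℝ] Mat :=
  LinearMap.toContinuousLinearMap
    { toFun := Yof, map_add' := Yof_add, map_smul' := Yof_smul }

/-- `YofCLM v = Yof v`. [folklore] -/
@[simp] theorem YofCLM_apply (v : ℂ × ℝ) : YofCLM v = Yof v := rfl

/-- `Xof v` is Hermitian. [folklore] -/
theorem conjTranspose_Xof (v : ℂ × ℝ) : (Xof v)ᴴ = Xof v := by
  ext i j; fin_cases i <;> fin_cases j <;> simp [Xof, Complex.conj_ofReal]

/-- `Xof v` is traceless. [folklore] -/
theorem trace_Xof (v : ℂ × ℝ) : (Xof v).trace = 0 := by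
  simp [Matrix.trace, Fin.sum_univ_two, Xof]

/-- `Yof v` is skew-Hermitian. [folklore] -/
theorem conjTranspose_Yof (v : ℂ × ℝ) : (Yof v)ᴴ = -Yof v := by
  ext i j; fin_cases i <;> fin_cases j <;> simp [Yof]

/-- `vof (Xof v) = v`. [folklore] -/
@[simp] theorem vof_Xof (v : ℂ × ℝ) : vof (Xof v) = v := by
  refine Prod.ext (by simp [vof, Xof]) (by simp [vof, Xof])

/-- **`Xof ∘ vof = id` on `𝔭₀`**: a traceless Hermitian `2 × 2` matrix is `X(v)` for
`v = (X₀₁, Re X₀₀)`. [cite: Garrett2018, §1.6] -/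
theorem Xof_vof {X : Mat} (hX : Xᴴ = X) (htr : X.trace = 0) : Xof (vof X) = X := by
  have h00 : conj (X 0 0) = X 0 0 := by
    have := congr_fun (congr_fun hX 0) 0; simpa [conjTranspose_apply] using this
  have h10 : X 1 0 = conj (X 0 1) := by
    have := congr_fun (congr_fun hX 1) 0; simpa [conjTranspose_apply] using this.symm
  have htr' : X 0 0 + X 1 1 = 0 := by simpa [Matrix.trace, Fin.sum_univ_two] using htr
  have h00re : ((X 0 0).re : ℂ) = X 0 0 := Complex.conj_eq_iff_re.1 h00
  ext i j
  fin_cases i <;> fin_cases j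
  · simp [Xof, vof, h00re]
  · simp [Xof, vof]
  · simp [Xof, vof, h10]
  · simp only [Xof, vof, Fin.mk_one, Fin.isValue, of_apply, cons_val', cons_val_one,
      cons_val_fin_one, h00re]
    linear_combination -htr'

/-! ### The Iwasawa section -/

/-- **The Iwasawa section** `(z, r) ↦ n_z a_r = (√r, z/√r; 0, 1/√r)` of the orbit map
(junk for `r ≤ 0` through `Real.sqrt`). [cite: ElstrodtGrunewaldMennicke1998, Ch. 1 §1.1]
[cite: Garrett2018, §1.3] -/
def sec (p : ℂ × ℝ) : Mat :=
  !![((Real.sqrt p.2 : ℝ) : ℂ), p.1 / ((Real.sqrt p.2 : ℝ) : ℂ);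
     0, 1 / ((Real.sqrt p.2 : ℝ) : ℂ)]

/-- Entry `(0,0)` of `sec`. [folklore] -/
@[simp] theorem sec_apply_00 (p : ℂ × ℝ) : sec p 0 0 = ((Real.sqrt p.2 : ℝ) : ℂ) := rfl
/-- Entry `(0,1)` of `sec`. [folklore] -/
@[simp] theorem sec_apply_01 (p : ℂ × ℝ) : sec p 0 1 = p.1 / ((Real.sqrt p.2 : ℝ) : ℂ) := rfl
/-- Entry `(1,0)` of `sec`. [folklore] -/
@[simp] theorem sec_apply_10 (p : ℂ × ℝ) : sec p 1 0 = 0 := rfl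
/-- Entry `(1,1)` of `sec`. [folklore] -/
@[simp] theorem sec_apply_11 (p : ℂ × ℝ) : sec p 1 1 = 1 / ((Real.sqrt p.2 : ℝ) : ℂ) := rfl

/-- `det (sec p) = 1` for `r > 0`. [cite: Garrett2018, §1.3] -/
theorem det_sec {p : ℂ × ℝ} (hp : 0 < p.2) : (sec p).det = 1 := by
  have hs : ((Real.sqrt p.2 : ℝ) : ℂ) ≠ 0 := ofReal_ne_zero.2 (Real.sqrt_pos.2 hp).ne'
  rw [det_fin_two]
  simp [sec]
  field_simp

/-- `sec p ∈ Inv` for `r > 0`. [folklore] -/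
theorem isUnit_det_sec {p : ℂ × ℝ} (hp : 0 < p.2) : IsUnit (sec p).det := by
  rw [det_sec hp]; exact isUnit_one

/-- **`sec` is a section of the orbit map**: `proj (sec p) = p` for `r > 0` (the tree's
`smul_upperTriangular`). [cite: Garrett2018, §1.3] -/
theorem proj_sec {p : ℂ × ℝ} (hp : 0 < p.2) : proj (sec p) = p := by
  have hsq : 0 < Real.sqrt p.2 := Real.sqrt_pos.2 hp
  have hs : ((Real.sqrt p.2 : ℝ) : ℂ) ≠ 0 := ofReal_ne_zero.2 hsq.ne'
  rw [proj_of_isUnit (isUnit_det_sec hp)]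
  set g := Matrix.GeneralLinearGroup.mk'' (sec p) (isUnit_det_sec hp) with hg
  have hgs : ∀ i j, g i j = sec p i j := fun i j => by simp [hg]
  obtain ⟨hz, hr⟩ := smul_upperTriangular g (by rw [hgs]; rfl) (default : ℍ³)
  refine Prod.ext ?_ ?_
  · change (g • (default : ℍ³)).z = p.1
    rw [hz, hgs, hgs, hgs]
    simp only [z_default, mul_zero, zero_add, sec_apply_01, sec_apply_11]
    field_simp
  · change (g • (default : ℍ³)).r = p.2
    rw [hr, hgs, hgs]
    simp only [r_default, mul_one, sec_apply_00, sec_apply_11]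
    rw [div_div_eq_mul_div, div_one, norm_mul, Complex.norm_real, Real.norm_eq_abs,
      abs_of_pos hsq, Real.mul_self_sqrt hp.le]

/-- **Upper triangular matrices act affinely**: `proj (sec p * N) = (r z' + z, r r')` for
`(z', r') = proj N`, `N ∈ Inv`, `p = (z, r)`, `r > 0` (the tree's `smul_upperTriangular`).
[cite: ElstrodtGrunewaldMennicke1998, Ch. 1 §1.1] -/
theorem proj_sec_mul {p : ℂ × ℝ} (hp : 0 < p.2) {N : Mat} (hN : IsUnit N.det) :
    proj (sec p * N) = ((p.2 : ℂ) * (proj N).1 + p.1, p.2 * (proj N).2) := by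
  have hsq : 0 < Real.sqrt p.2 := Real.sqrt_pos.2 hp
  have hs : ((Real.sqrt p.2 : ℝ) : ℂ) ≠ 0 := ofReal_ne_zero.2 hsq.ne'
  rw [proj_mul (isUnit_det_sec hp) hN, proj_of_isUnit hN]
  set g := Matrix.GeneralLinearGroup.mk'' (sec p) (isUnit_det_sec hp) with hg
  set P := Matrix.GeneralLinearGroup.mk'' N hN • (default : ℍ³) with hP
  have hgs : ∀ i j, g i j = sec p i j := fun i j => by simp [hg]
  obtain ⟨hz, hr⟩ := smul_upperTriangular g (by rw [hgs]; rfl) P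
  refine Prod.ext ?_ ?_
  · change (g • P).z = (p.2 : ℂ) * P.z + p.1
    rw [hz, hgs, hgs, hgs]
    simp only [sec_apply_00, sec_apply_01, sec_apply_11]
    field_simp
    rw [← ofReal_pow, Real.sq_sqrt hp.le]
    ring
  · change (g • P).r = p.2 * P.r
    rw [hr, hgs, hgs]
    simp only [sec_apply_00, sec_apply_11]
    rw [div_div_eq_mul_div, div_one, norm_mul, Complex.norm_real, Real.norm_eq_abs,
      abs_of_pos hsq, Real.mul_self_sqrt hp.le]

/-- **The Hermitian form of the section**: `sec p (sec p)ᴴ = (r + |z|²/r, z/r; z̄/r, 1/r)`.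
[cite: Garrett2018, §1.3] -/
theorem sec_mul_conjTranspose {p : ℂ × ℝ} (hp : 0 < p.2) :
    sec p * (sec p)ᴴ =
      !![((p.2 : ℂ) + (normSq p.1 : ℂ) / p.2), p.1 / p.2; conj p.1 / p.2, 1 / (p.2 : ℂ)] := by
  have hsq : 0 < Real.sqrt p.2 := Real.sqrt_pos.2 hp
  have hs : ((Real.sqrt p.2 : ℝ) : ℂ) ≠ 0 := ofReal_ne_zero.2 hsq.ne'
  have hr : (p.2 : ℂ) ≠ 0 := ofReal_ne_zero.2 hp.ne'
  have hss : ((Real.sqrt p.2 : ℝ) : ℂ) * ((Real.sqrt p.2 : ℝ) : ℂ) = p.2 := by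
    rw [← ofReal_mul, Real.mul_self_sqrt hp.le]
  ext i j
  fin_cases i <;> fin_cases j <;>
    simp [sec, Matrix.mul_apply, Fin.sum_univ_two, conjTranspose_apply, Complex.conj_ofReal,
      normSq_eq_conj_mul_self] <;> field_simp <;> rw [← hss] <;> ring

/-- **Iwasawa decomposition of `GL₂(ℂ)` along the section**: every invertible `M` is
`sec (proj M) * (c • k)` with `c = |det M|^{1/2} > 0` and `k` unitary — equivalently
`M Mᴴ = |det M| · sec (proj M) (sec (proj M))ᴴ`, the `2 × 2` identity
`det (M Mᴴ) = |det M|²`. [cite: ElstrodtGrunewaldMennicke1998, Ch. 1 §1.1]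
[cite: Garrett2018, §1.3 (G = P K, Claim 1.3.2)] -/
theorem exists_eq_sec_mul_smul {M : Mat} (hM : IsUnit M.det) :
    ∃ (c : ℝ) (k : Mat), 0 < c ∧ k ∈ Matrix.unitaryGroup (Fin 2) ℂ ∧
      M = sec (proj M) * ((c : ℂ) • k) := by
  have hD := denom_pos hM
  have hD' : ((normSq (M 1 1) : ℂ) + normSq (M 1 0)) ≠ 0 := by
    rw [← ofReal_add]; exact ofReal_ne_zero.2 hD.ne'
  have hn : 0 < ‖M.det‖ := norm_pos_iff.2 hM.ne_zero
  have hn0 : ((‖M.det‖ : ℝ) : ℂ) ≠ 0 := ofReal_ne_zero.2 hn.ne'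
  set c : ℝ := Real.sqrt ‖M.det‖ with hc
  have hc0 : 0 < c := Real.sqrt_pos.2 hn
  have hcc : ((c : ℂ) * c) = ((‖M.det‖ : ℝ) : ℂ) := by
    rw [← ofReal_mul, Real.mul_self_sqrt hn.le]
  have hcne : (c : ℂ) ≠ 0 := ofReal_ne_zero.2 hc0.ne'
  set p := proj M with hpdef
  have hp : 0 < p.2 := proj_snd_pos M
  have hp1 : p.1 = (M 0 1 * conj (M 1 1) + M 0 0 * conj (M 1 0)) /
      ((normSq (M 1 1) : ℂ) + normSq (M 1 0)) := by
    rw [hpdef, proj_eq hM]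
  have hp2 : (p.2 : ℂ) = ((‖M.det‖ : ℝ) : ℂ) / ((normSq (M 1 1) : ℂ) + normSq (M 1 0)) := by
    rw [hpdef, proj_eq hM]; push_cast; ring
  have hs := isUnit_det_sec hp
  set s := sec p with hsdef
  have hsinv : s⁻¹ * s = 1 := Matrix.nonsing_inv_mul s hs
  have hsinv' : s * s⁻¹ = 1 := Matrix.mul_nonsing_inv s hs
  -- `M Mᴴ = |det M| · s sᴴ` (the identity `det (M Mᴴ) = |det M|²`)
  have hnn : ((‖M.det‖ : ℝ) : ℂ) * ((‖M.det‖ : ℝ) : ℂ) = M.det * conj M.det := by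
    rw [← ofReal_mul, ← sq, ← Complex.normSq_eq_norm_sq, Complex.mul_conj]
  have h2 : ((‖M.det‖ : ℝ) : ℂ) ^ 2 = (M 0 0 * M 1 1 - M 0 1 * M 1 0) *
      (conj (M 0 0) * conj (M 1 1) - conj (M 0 1) * conj (M 1 0)) := by
    rw [sq, hnn, det_fin_two, map_sub, map_mul, map_mul]
  have hDc : (normSq (M 1 1) : ℂ) + normSq (M 1 0) =
      M 1 1 * conj (M 1 1) + M 1 0 * conj (M 1 0) := by
    rw [← Complex.mul_conj, ← Complex.mul_conj]
  have hDne : M 1 1 * conj (M 1 1) + M 1 0 * conj (M 1 0) ≠ 0 := by rw [← hDc]; exact hD'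
  have key : M * Mᴴ = ((‖M.det‖ : ℝ) : ℂ) • (s * sᴴ) := by
    rw [hsdef, sec_mul_conjTranspose hp, ← Complex.mul_conj p.1, hp1, hp2]
    simp only [map_div₀, map_add, map_mul, Complex.conj_conj, Complex.conj_ofReal]
    ext i j
    fin_cases i <;> fin_cases j
    · simp only [Matrix.mul_apply, Fin.sum_univ_two, conjTranspose_apply, RCLike.star_def,
        Matrix.smul_apply, smul_eq_mul, Fin.mk_zero, Fin.isValue, of_apply, cons_val',
        cons_val_zero, cons_val_fin_one]
      field_simp
      simp only [← Complex.mul_conj]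
      linear_combination -h2
    · simp only [Matrix.mul_apply, Fin.sum_univ_two, conjTranspose_apply, RCLike.star_def,
        Matrix.smul_apply, smul_eq_mul, Fin.mk_zero, Fin.mk_one, Fin.isValue, of_apply, cons_val',
        cons_val_zero, cons_val_one, cons_val_fin_one]
      field_simp
      ring
    · simp only [Matrix.mul_apply, Fin.sum_univ_two, conjTranspose_apply, RCLike.star_def,
        Matrix.smul_apply, smul_eq_mul, Fin.mk_zero, Fin.mk_one, Fin.isValue, of_apply, cons_val',
        cons_val_zero, cons_val_one, cons_val_fin_one]
      field_simp
      ring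
    · simp only [Matrix.mul_apply, Fin.sum_univ_two, conjTranspose_apply, RCLike.star_def,
        Matrix.smul_apply, smul_eq_mul, Fin.mk_one, Fin.isValue, of_apply, cons_val',
        cons_val_one, cons_val_fin_one]
      field_simp
      simp only [← Complex.mul_conj]
      ring
  -- the unitary factor
  set k : Mat := ((c : ℂ)⁻¹) • (s⁻¹ * M) with hk
  refine ⟨c, k, hc0, ?_, ?_⟩
  · rw [Matrix.mem_unitaryGroup_iff, hk, star_eq_conjTranspose, conjTranspose_smul,
      conjTranspose_mul, Matrix.smul_mul, Matrix.mul_smul, smul_smul, RCLike.star_def,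
      Complex.conj_inv, Complex.conj_ofReal]
    have hass : s⁻¹ * M * (Mᴴ * (s⁻¹)ᴴ) = s⁻¹ * (M * Mᴴ) * (s⁻¹)ᴴ := by
      simp only [Matrix.mul_assoc]
    rw [hass, key, Matrix.mul_smul, Matrix.smul_mul, ← Matrix.mul_assoc, hsinv, Matrix.one_mul,
      ← conjTranspose_mul, hsinv, conjTranspose_one, smul_smul, ← hcc]
    rw [show (c : ℂ)⁻¹ * (c : ℂ)⁻¹ * ((c : ℂ) * c) = 1 by field_simp, one_smul]
  · rw [hk, Matrix.mul_smul, Matrix.mul_smul, smul_smul, mul_inv_cancel₀ hcne, one_smul,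
      ← Matrix.mul_assoc, hsinv', Matrix.one_mul]

/-! ### Smoothness of the orbit map and of the section -/

/-- `M₂(ℂ)` is finite-dimensional over `ℝ`. [folklore] -/
instance : FiniteDimensional ℝ Mat := FiniteDimensional.complexToReal Mat

/-- The entry `M ↦ M i j` as a real-linear map. [folklore] -/
def entryLM (i j : Fin 2) : Mat →ₗ[ℝ] ℂ where
  toFun M := M i j
  map_add' _ _ := rfl
  map_smul' _ _ := rfl

/-- The entry `M ↦ M i j` as a continuous real-linear map. [folklore] -/
def entryCLM (i j : Fin 2) : Mat →L[ℝ] ℂ := LinearMap.toContinuousLinearMap (entryLM i j)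

/-- `entryCLM i j M = M i j`. [folklore] -/
@[simp] theorem entryCLM_apply (i j : Fin 2) (M : Mat) : entryCLM i j M = M i j := rfl

/-- Entries are smooth functions of the matrix. [folklore] -/
theorem contDiff_entry (i j : Fin 2) {n : WithTop ℕ∞} : ContDiff ℝ n (fun M : Mat => M i j) :=
  (entryCLM i j).contDiff

/-- Complex conjugation is smooth over `ℝ`. [folklore] -/
theorem contDiff_conj {n : WithTop ℕ∞} : ContDiff ℝ n (fun z : ℂ => conj z) :=
  Complex.conjCLE.contDiff

/-- The determinant of a `2 × 2` matrix is a smooth function. [folklore] -/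
theorem contDiff_det {n : WithTop ℕ∞} : ContDiff ℝ n (fun M : Mat => M.det) := by
  have h : (fun M : Mat => M.det) = fun M => M 0 0 * M 1 1 - M 0 1 * M 1 0 := by
    funext M; exact det_fin_two M
  rw [h]
  exact ((contDiff_entry 0 0).mul (contDiff_entry 1 1)).sub
    ((contDiff_entry 0 1).mul (contDiff_entry 1 0))

/-- The explicit formula for `proj` (right-hand side of `proj_eq`) as a function on all of
`M₂(ℂ)`. [folklore] -/
def projFormula (M : Mat) : ℂ × ℝ :=
  ((M 0 1 * conj (M 1 1) + M 0 0 * conj (M 1 0)) / ((normSq (M 1 1) : ℂ) + (normSq (M 1 0) : ℂ)),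
    ‖M.det‖ / (normSq (M 1 1) + normSq (M 1 0)))

/-- `proj = projFormula` on `Inv`. [folklore] -/
theorem proj_eq_projFormula {M : Mat} (h : IsUnit M.det) : proj M = projFormula M := proj_eq h

/-- **The explicit formula is smooth on `Inv`** (rational functions of the entries and `|det M|`,
the norm being smooth off `0`). [folklore] -/
theorem contDiffOn_projFormula : ContDiffOn ℝ ∞ projFormula Inv := by
  have hDr : ContDiff ℝ ∞ (fun M : Mat => normSq (M 1 1) + normSq (M 1 0)) := by
    have h : (fun M : Mat => normSq (M 1 1) + normSq (M 1 0)) =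
        fun M => ‖M 1 1‖ ^ 2 + ‖M 1 0‖ ^ 2 := by
      funext M; rw [normSq_eq_norm_sq, normSq_eq_norm_sq]
    rw [h]
    exact ((contDiff_entry 1 1).norm_sq ℝ).add ((contDiff_entry 1 0).norm_sq ℝ)
  have hDne : ∀ M ∈ Inv, normSq (M 1 1) + normSq (M 1 0) ≠ 0 := fun M hM => (denom_pos hM).ne'
  have hDc : ContDiff ℝ ∞ (fun M : Mat => ((normSq (M 1 1) : ℂ) + (normSq (M 1 0) : ℂ))) := by
    have h : (fun M : Mat => ((normSq (M 1 1) : ℂ) + (normSq (M 1 0) : ℂ))) =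
        fun M => ((normSq (M 1 1) + normSq (M 1 0) : ℝ) : ℂ) := by
      funext M; push_cast; rfl
    rw [h]
    exact Complex.ofRealCLM.contDiff.comp hDr
  have hDcne : ∀ M ∈ Inv, ((normSq (M 1 1) : ℂ) + (normSq (M 1 0) : ℂ)) ≠ 0 := by
    intro M hM
    rw [← ofReal_add]; exact ofReal_ne_zero.2 (hDne M hM)
  have hN : ContDiff ℝ ∞ (fun M : Mat => M 0 1 * conj (M 1 1) + M 0 0 * conj (M 1 0)) :=
    ((contDiff_entry 0 1).mul (contDiff_conj.comp (contDiff_entry 1 1))).add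
      ((contDiff_entry 0 0).mul (contDiff_conj.comp (contDiff_entry 1 0)))
  have hfst : ContDiffOn ℝ ∞ (fun M : Mat =>
      (M 0 1 * conj (M 1 1) + M 0 0 * conj (M 1 0)) /
        ((normSq (M 1 1) : ℂ) + (normSq (M 1 0) : ℂ))) Inv := by
    simp only [div_eq_mul_inv]
    exact hN.contDiffOn.mul (hDc.contDiffOn.inv hDcne)
  have hnorm : ContDiffOn ℝ ∞ (fun M : Mat => ‖M.det‖) Inv := fun M hM =>
    ((contDiff_det.contDiffAt).norm ℝ (mem_Inv.1 hM).ne_zero).contDiffWithinAt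
  have hsnd : ContDiffOn ℝ ∞ (fun M : Mat => ‖M.det‖ / (normSq (M 1 1) + normSq (M 1 0))) Inv :=
    hnorm.div hDr.contDiffOn hDne
  exact hfst.prodMk hsnd

/-- **The orbit map is smooth on `GL₂(ℂ)`.** [cite: ElstrodtGrunewaldMennicke1998, Ch. 1 §1.1] -/
theorem contDiffOn_proj : ContDiffOn ℝ ∞ proj Inv :=
  contDiffOn_projFormula.congr fun _ hM => proj_eq_projFormula hM

/-- **The section in the standard basis**: `sec p = √r E₀₀ + (√r)⁻¹ z E₀₁ + (√r)⁻¹ E₁₁`. [folklore] -/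
theorem sec_eq_smul_single (p : ℂ × ℝ) :
    sec p = ((Real.sqrt p.2 : ℝ) : ℂ) • Matrix.single 0 0 (1 : ℂ) +
      ((((Real.sqrt p.2)⁻¹ : ℝ) : ℂ) * p.1) • Matrix.single 0 1 (1 : ℂ) +
      (((Real.sqrt p.2)⁻¹ : ℝ) : ℂ) • Matrix.single 1 1 (1 : ℂ) := by
  ext i j
  fin_cases i <;> fin_cases j <;> simp [sec, Matrix.single, div_eq_mul_inv, mul_comm]

/-- The scalar `p ↦ √r` is smooth on the half-space. [folklore] -/
theorem contDiffOn_sqrt_snd : ContDiffOn ℝ ∞ (fun p : ℂ × ℝ => Real.sqrt p.2) {p | 0 < p.2} :=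
  fun q hq => ((Real.contDiffAt_sqrt (ne_of_gt hq)).comp q contDiffAt_snd).contDiffWithinAt

/-- The scalar `p ↦ (√r)⁻¹` is smooth on the half-space. [folklore] -/
theorem contDiffOn_inv_sqrt_snd :
    ContDiffOn ℝ ∞ (fun p : ℂ × ℝ => (Real.sqrt p.2)⁻¹) {p | 0 < p.2} :=
  contDiffOn_sqrt_snd.inv fun _ hp => (Real.sqrt_pos.2 hp).ne'

/-- **The section is smooth on the half-space.** [cite: Garrett2018, §1.3] -/
theorem contDiffOn_sec : ContDiffOn ℝ ∞ sec {p : ℂ × ℝ | 0 < p.2} := by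
  have h1 : ContDiffOn ℝ ∞ (fun p : ℂ × ℝ => ((Real.sqrt p.2 : ℝ) : ℂ)) {p | 0 < p.2} :=
    Complex.ofRealCLM.contDiff.comp_contDiffOn contDiffOn_sqrt_snd
  have h2 : ContDiffOn ℝ ∞ (fun p : ℂ × ℝ => (((Real.sqrt p.2)⁻¹ : ℝ) : ℂ)) {p | 0 < p.2} :=
    Complex.ofRealCLM.contDiff.comp_contDiffOn contDiffOn_inv_sqrt_snd
  have h3 : ContDiffOn ℝ ∞ (fun p : ℂ × ℝ => (((Real.sqrt p.2)⁻¹ : ℝ) : ℂ) * p.1) {p | 0 < p.2} :=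
    h2.mul contDiff_fst.contDiffOn
  have h : sec = fun p : ℂ × ℝ => ((Real.sqrt p.2 : ℝ) : ℂ) • Matrix.single 0 0 (1 : ℂ) +
      ((((Real.sqrt p.2)⁻¹ : ℝ) : ℂ) * p.1) • Matrix.single 0 1 (1 : ℂ) +
      (((Real.sqrt p.2)⁻¹ : ℝ) : ℂ) • Matrix.single 1 1 (1 : ℂ) := funext sec_eq_smul_single
  rw [h]
  exact ((h1.smul contDiffOn_const).add (h3.smul contDiffOn_const)).add (h2.smul contDiffOn_const)

/-! ### The differential of the section: the Iwasawa frame -/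

/-- **The Iwasawa frame** `Z_p(v) = (2r)⁻¹ (X(v) + Y(v)) = (2r)⁻¹ (v_r, 2v_z; 0, −v_r)`: the
left-trivialised differential of the section, `D sec(p) v = sec p * Z_p(v)`.
[cite: Garrett2018, §1.6] -/
def frame (p : ℂ × ℝ) (v : ℂ × ℝ) : Mat := ((2 * p.2)⁻¹ : ℝ) • (Xof v + Yof v)

/-- The frame in coordinates: `Z_p(v) = (2r)⁻¹ (v_r, 2v_z; 0, −v_r)`. [folklore] -/
theorem frame_eq (p v : ℂ × ℝ) :
    frame p v = ((2 * p.2)⁻¹ : ℝ) • !![(v.2 : ℂ), 2 * v.1; 0, -(v.2 : ℂ)] := by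
  unfold frame
  congr 1
  ext i j; fin_cases i <;> fin_cases j <;> simp [Xof, Yof]; ring

/-- **The differential of the section as a continuous linear map**: `v ↦ sec p * Z_p(v)`.
[cite: Garrett2018, §1.6] -/
def secDeriv (p : ℂ × ℝ) : ℂ × ℝ →L[ℝ] Mat :=
  ((2 * p.2)⁻¹ : ℝ) • ((ContinuousLinearMap.mul ℝ Mat (sec p)).comp (XofCLM + YofCLM))

/-- `secDeriv p v = sec p * Z_p(v)`. [folklore] -/
theorem secDeriv_apply (p v : ℂ × ℝ) : secDeriv p v = sec p * frame p v := by
  change ((2 * p.2)⁻¹ : ℝ) • ((ContinuousLinearMap.mul ℝ Mat (sec p)) (XofCLM v + YofCLM v)) =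
    sec p * (((2 * p.2)⁻¹ : ℝ) • (Xof v + Yof v))
  rw [ContinuousLinearMap.mul_apply', XofCLM_apply, YofCLM_apply, Matrix.mul_smul]

/-- **`D sec(p) = secDeriv p`** for `r > 0`: entrywise, `d(√r) = dr/(2√r)`,
`d(z/√r) = dz/√r − z dr/(2r√r)`, `d(1/√r) = −dr/(2r√r)`, which is `sec p * Z_p(·)`.
[cite: Garrett2018, §1.3 and §1.6] -/
theorem hasFDerivAt_sec {p : ℂ × ℝ} (hp : 0 < p.2) : HasFDerivAt sec (secDeriv p) p := by
  have hsq : 0 < Real.sqrt p.2 := Real.sqrt_pos.2 hp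
  have hsqne : Real.sqrt p.2 ≠ 0 := hsq.ne'
  set e00 : Mat := Matrix.single 0 0 1 with he00
  set e01 : Mat := Matrix.single 0 1 1 with he01
  set e11 : Mat := Matrix.single 1 1 1 with he11
  -- the real scalars `√r`, `(√r)⁻¹`
  have hS : HasFDerivAt (fun q : ℂ × ℝ => Real.sqrt q.2)
      ((1 / (2 * Real.sqrt p.2)) • ContinuousLinearMap.snd ℝ ℂ ℝ) p :=
    (Real.hasDerivAt_sqrt (ne_of_gt hp)).comp_hasFDerivAt p hasFDerivAt_snd
  have hI : HasFDerivAt (fun q : ℂ × ℝ => (Real.sqrt q.2)⁻¹)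
      ((-(Real.sqrt p.2 ^ 2)⁻¹) • ((1 / (2 * Real.sqrt p.2)) • ContinuousLinearMap.snd ℝ ℂ ℝ)) p :=
    (hasDerivAt_inv hsqne).comp_hasFDerivAt p hS
  -- complexified scalars
  have hSc : HasFDerivAt (fun q : ℂ × ℝ => ((Real.sqrt q.2 : ℝ) : ℂ))
      (Complex.ofRealCLM.comp ((1 / (2 * Real.sqrt p.2)) • ContinuousLinearMap.snd ℝ ℂ ℝ)) p :=
    Complex.ofRealCLM.hasFDerivAt.comp p hS
  have hIc : HasFDerivAt (fun q : ℂ × ℝ => (((Real.sqrt q.2)⁻¹ : ℝ) : ℂ))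
      (Complex.ofRealCLM.comp
        ((-(Real.sqrt p.2 ^ 2)⁻¹) • ((1 / (2 * Real.sqrt p.2)) • ContinuousLinearMap.snd ℝ ℂ ℝ))) p :=
    Complex.ofRealCLM.hasFDerivAt.comp p hI
  have hF : HasFDerivAt (fun q : ℂ × ℝ => q.1) (ContinuousLinearMap.fst ℝ ℂ ℝ) p := hasFDerivAt_fst
  have hIz := hIc.mul hF
  -- assemble `sec = √r • E₀₀ + ((√r)⁻¹ z) • E₀₁ + (√r)⁻¹ • E₁₁`
  have hsum := ((hSc.smul_const e00).add (hIz.smul_const e01)).add (hIc.smul_const e11)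
  have hfun : sec = fun q : ℂ × ℝ => ((Real.sqrt q.2 : ℝ) : ℂ) • e00 +
      ((((Real.sqrt q.2)⁻¹ : ℝ) : ℂ) * q.1) • e01 + (((Real.sqrt q.2)⁻¹ : ℝ) : ℂ) • e11 :=
    funext sec_eq_smul_single
  rw [hfun]
  refine hsum.congr_fderiv ?_
  -- compare the two continuous linear maps entrywise
  have hss : ((Real.sqrt p.2 : ℝ) : ℂ) * ((Real.sqrt p.2 : ℝ) : ℂ) = p.2 := by
    rw [← ofReal_mul, Real.mul_self_sqrt hp.le]
  have hs : ((Real.sqrt p.2 : ℝ) : ℂ) ≠ 0 := ofReal_ne_zero.2 hsqne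
  refine ContinuousLinearMap.ext fun v => ?_
  refine Eq.trans ?_ ((secDeriv_apply p v).trans (congrArg (sec p * ·) (frame_eq p v))).symm
  ext i j
  fin_cases i <;> fin_cases j <;>
    simp [he00, he01, he11, sec, Matrix.mul_apply, Fin.sum_univ_two, Matrix.single]
  all_goals rw [← hss]; field_simp

/-! ### The differential of the orbit map at the identity -/

/-- **The tangent map of the orbit map at `1`**: for every `X ∈ M₂(ℂ)`,
`DΠ(X) = (X₀₁ + X̄₁₀, Re X₀₀ − Re X₁₁) ∈ ℂ × ℝ = T_j ℍ³`; on `𝔭₀` this is `2 · vof X`, and it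
kills `𝔲(2) ⊕ ℝ · 1`. [cite: Garrett2018, §1.6] -/
def tangentMap (X : Mat) : ℂ × ℝ := (X 0 1 + conj (X 1 0), (X 0 0).re - (X 1 1).re)

/-- `tangentMap X = 2 • vof X` for traceless Hermitian `X`. [cite: Garrett2018, §1.6] -/
theorem tangentMap_of_isHerm {X : Mat} (hX : Xᴴ = X) (htr : X.trace = 0) :
    tangentMap X = (2 : ℝ) • vof X := by
  have h10 : conj (X 1 0) = X 0 1 := by
    have := congr_fun (congr_fun hX 0) 1; simpa [conjTranspose_apply] using this
  have htr' : X 0 0 + X 1 1 = 0 := by simpa [Matrix.trace, Fin.sum_univ_two] using htr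
  have h11 : (X 1 1).re = -(X 0 0).re := by
    have := congrArg Complex.re htr'
    simp only [add_re, zero_re] at this
    linarith
  refine Prod.ext ?_ ?_
  · simp only [tangentMap, h10, Prod.smul_fst, vof_fst, Complex.real_smul]; push_cast; ring
  · simp only [tangentMap, h11, Prod.smul_snd, vof_snd, smul_eq_mul]; ring

/-- `tangentMap Y = 0` for skew-Hermitian `Y`. [cite: Garrett2018, §1.6] -/
theorem tangentMap_of_skewHerm {Y : Mat} (hY : Yᴴ = -Y) : tangentMap Y = 0 := by
  have h10 : conj (Y 1 0) = -Y 0 1 := by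
    have := congr_fun (congr_fun hY 0) 1; simpa [conjTranspose_apply] using this
  have h00 : (Y 0 0).re = 0 := by
    have := congr_fun (congr_fun hY 0) 0
    simp only [conjTranspose_apply, RCLike.star_def, Matrix.neg_apply] at this
    have h := congrArg Complex.re this
    simp only [Complex.conj_re, Complex.neg_re] at h
    linarith
  have h11 : (Y 1 1).re = 0 := by
    have := congr_fun (congr_fun hY 1) 1
    simp only [conjTranspose_apply, RCLike.star_def, Matrix.neg_apply] at this
    have h := congrArg Complex.re this
    simp only [Complex.conj_re, Complex.neg_re] at h
    linarith
  refine Prod.ext ?_ ?_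
  · simp [tangentMap, h10]
  · simp [tangentMap, h00, h11]

/-- `tangentMap (c • 1) = 0` for real `c` (the centre direction `𝔞_G`). [folklore] -/
theorem tangentMap_smul_one (c : ℝ) : tangentMap ((c : ℂ) • (1 : Mat)) = 0 := by
  refine Prod.ext ?_ ?_ <;> simp [tangentMap]

/-- Entries of the curve `t ↦ 1 + tX` are differentiable with derivative `X i j`. [folklore] -/
theorem hasDerivAt_one_add_smul_apply (X : Mat) (i j : Fin 2) (t : ℝ) :
    HasDerivAt (fun s : ℝ => ((1 : Mat) + s • X) i j) (X i j) t := by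
  have h : (fun s : ℝ => ((1 : Mat) + s • X) i j) = fun s => (1 : Mat) i j + s • X i j := by
    funext s; simp [Matrix.add_apply, Matrix.smul_apply]
  rw [h]
  simpa using ((hasDerivAt_id t).smul_const (X i j)).const_add ((1 : Mat) i j)

/-- **The derivative of the explicit formula along `t ↦ 1 + tX` at `t = 0`** is `tangentMap X`:
numerator `N = b d̄ + a c̄` has `N(0) = 0`, `N'(0) = X₀₁ + X̄₁₀`; denominator
`D = |d|² + |c|²` has `D(0) = 1`, `D'(0) = 2 Re X₁₁`; `|det|' (0) = Re (X₀₀ + X₁₁)`.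
[cite: Garrett2018, §1.6] -/
theorem hasDerivAt_projFormula_one_add_smul (X : Mat) :
    HasDerivAt (fun t : ℝ => projFormula ((1 : Mat) + t • X)) (tangentMap X) 0 := by
  -- entries
  have ha := hasDerivAt_one_add_smul_apply X 0 0 0
  have hb := hasDerivAt_one_add_smul_apply X 0 1 0
  have hc := hasDerivAt_one_add_smul_apply X 1 0 0
  have hd := hasDerivAt_one_add_smul_apply X 1 1 0
  have e00 : ((1 : Mat) + (0 : ℝ) • X) 0 0 = 1 := by simp
  have e01 : ((1 : Mat) + (0 : ℝ) • X) 0 1 = 0 := by simp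
  have e10 : ((1 : Mat) + (0 : ℝ) • X) 1 0 = 0 := by simp
  have e11 : ((1 : Mat) + (0 : ℝ) • X) 1 1 = 1 := by simp
  -- numerator of the `z`-coordinate
  have hN : HasDerivAt (fun t : ℝ => ((1 : Mat) + t • X) 0 1 * conj (((1 : Mat) + t • X) 1 1) +
      ((1 : Mat) + t • X) 0 0 * conj (((1 : Mat) + t • X) 1 0)) (X 0 1 + conj (X 1 0)) 0 := by
    have h := (hb.mul hd.star).add (ha.mul hc.star)
    simp only [e00, e01, e10, e11, RCLike.star_def, star_one, mul_one, zero_mul, add_zero,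
      star_zero, mul_zero, zero_add, one_mul] at h
    exact h
  -- the real denominator
  have hD : HasDerivAt (fun t : ℝ => normSq (((1 : Mat) + t • X) 1 1) + normSq (((1 : Mat) + t • X) 1 0))
      (2 * (X 1 1).re) 0 := by
    have h := hd.norm_sq.add hc.norm_sq
    simp only [e11, e10, Complex.inner, map_one, mul_one, map_zero, mul_zero,
      Complex.zero_re, add_zero] at h
    have hfun : (fun t : ℝ => normSq (((1 : Mat) + t • X) 1 1) + normSq (((1 : Mat) + t • X) 1 0)) =
        fun t => ‖((1 : Mat) + t • X) 1 1‖ ^ 2 + ‖((1 : Mat) + t • X) 1 0‖ ^ 2 := by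
      funext t; rw [normSq_eq_norm_sq, normSq_eq_norm_sq]
    rw [hfun]
    exact h.congr_deriv (by ring)
  have hD0 : normSq (((1 : Mat) + (0 : ℝ) • X) 1 1) + normSq (((1 : Mat) + (0 : ℝ) • X) 1 0) = 1 := by
    simp
  -- the complex denominator
  have hDc : HasDerivAt (fun t : ℝ => ((normSq (((1 : Mat) + t • X) 1 1) : ℂ) +
      (normSq (((1 : Mat) + t • X) 1 0) : ℂ))) ((2 * (X 1 1).re : ℝ) : ℂ) 0 := by
    have h := Complex.ofRealCLM.hasFDerivAt.comp_hasDerivAt (0 : ℝ) hD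
    have hfun : (fun t : ℝ => ((normSq (((1 : Mat) + t • X) 1 1) : ℂ) +
        (normSq (((1 : Mat) + t • X) 1 0) : ℂ))) =
        Complex.ofRealCLM ∘ fun t => normSq (((1 : Mat) + t • X) 1 1) + normSq (((1 : Mat) + t • X) 1 0) := by
      funext t; simp
    rw [hfun]
    simpa using h
  have hDc0 : ((normSq (((1 : Mat) + (0 : ℝ) • X) 1 1) : ℂ) +
      (normSq (((1 : Mat) + (0 : ℝ) • X) 1 0) : ℂ)) = 1 := by simp
  -- the `z`-coordinate
  have hz : HasDerivAt (fun t : ℝ => (projFormula ((1 : Mat) + t • X)).1) (X 0 1 + conj (X 1 0)) 0 := by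
    have h := hN.div hDc (by rw [hDc0]; exact one_ne_zero)
    simp only [e00, e01, e10, e11, map_zero, map_one, mul_zero, mul_one, zero_mul, add_zero,
      sub_zero, one_pow, div_one, ofReal_one, ofReal_zero] at h
    exact h
  -- the determinant and its norm
  have hdet : HasDerivAt (fun t : ℝ => ((1 : Mat) + t • X).det) (X 0 0 + X 1 1) 0 := by
    have h := (ha.mul hd).sub (hb.mul hc)
    simp only [e00, e01, e10, e11, mul_one, one_mul, mul_zero, zero_mul, add_zero, sub_zero] at h
    have hfun : (fun t : ℝ => ((1 : Mat) + t • X).det) =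
        fun t => ((1 : Mat) + t • X) 0 0 * ((1 : Mat) + t • X) 1 1 -
          ((1 : Mat) + t • X) 0 1 * ((1 : Mat) + t • X) 1 0 := by
      funext t; exact det_fin_two _
    rw [hfun]
    exact h
  have hdet0 : ((1 : Mat) + (0 : ℝ) • X).det = 1 := by simp
  have hnorm : HasDerivAt (fun t : ℝ => ‖((1 : Mat) + t • X).det‖) ((X 0 0).re + (X 1 1).re) 0 := by
    have h2 := hdet.norm_sq
    simp only [hdet0, Complex.inner, map_one, mul_one] at h2
    have h1 : ‖((1 : Mat) + (0 : ℝ) • X).det‖ ^ 2 ≠ 0 := by rw [hdet0]; simp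
    have h3 := (Real.hasDerivAt_sqrt h1).comp (0 : ℝ) h2
    have hfun : (fun t : ℝ => ‖((1 : Mat) + t • X).det‖) =
        (fun y : ℝ => Real.sqrt y) ∘ fun t => ‖((1 : Mat) + t • X).det‖ ^ 2 := by
      funext t; simp [Real.sqrt_sq (norm_nonneg _)]
    rw [hfun]
    refine h3.congr_deriv ?_
    rw [hdet0, norm_one, one_pow, Real.sqrt_one, Complex.add_re]
    ring
  -- the `r`-coordinate
  have hr : HasDerivAt (fun t : ℝ => (projFormula ((1 : Mat) + t • X)).2) ((X 0 0).re - (X 1 1).re) 0 := by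
    have h := hnorm.div hD (by rw [hD0]; exact one_ne_zero)
    simp only [hD0, hdet0, norm_one, mul_one, one_mul, one_pow, div_one] at h
    exact h.congr_deriv (by ring)
  exact hz.prodMk hr

/-- **The derivative of the orbit map along `t ↦ 1 + tX` at `t = 0`** is `tangentMap X`.
[cite: Garrett2018, §1.6] -/
theorem hasDerivAt_proj_one_add_smul (X : Mat) :
    HasDerivAt (fun t : ℝ => proj ((1 : Mat) + t • X)) (tangentMap X) 0 := by
  refine (hasDerivAt_projFormula_one_add_smul X).congr_of_eventuallyEq ?_
  have hc : Continuous fun t : ℝ => (1 : Mat) + t • X := by fun_prop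
  have h1 : (1 : Mat) + (0 : ℝ) • X ∈ Inv := by simp
  filter_upwards [hc.continuousAt.preimage_mem_nhds (isOpen_Inv.mem_nhds h1)] with t ht
  exact proj_eq_projFormula ht

/-- `proj` is differentiable at the points of `Inv`. [folklore] -/
theorem differentiableAt_proj {M : Mat} (hM : IsUnit M.det) : DifferentiableAt ℝ proj M :=
  (contDiffOn_proj.differentiableOn (by simp)).differentiableAt (isOpen_Inv.mem_nhds hM)

/-- **The Fréchet derivative of the orbit map at `1`**: `Dproj(1) X = tangentMap X`.
[cite: Garrett2018, §1.6] -/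
theorem fderiv_proj_one_apply (X : Mat) : fderiv ℝ proj 1 X = tangentMap X := by
  have hd : DifferentiableAt ℝ proj (1 : Mat) := differentiableAt_proj (by simp)
  have hγ : HasDerivAt (fun t : ℝ => (1 : Mat) + t • X) X 0 := by
    have h := ((hasDerivAt_id (0 : ℝ)).smul_const X).const_add (1 : Mat)
    rw [one_smul] at h
    exact h
  have h1 : HasDerivAt (fun t : ℝ => proj ((1 : Mat) + t • X)) (fderiv ℝ proj 1 X) 0 := by
    have e : (1 : Mat) + (0 : ℝ) • X = 1 := by simp
    have h : HasFDerivAt proj (fderiv ℝ proj 1) ((1 : Mat) + (0 : ℝ) • X) := by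
      rw [e]; exact hd.hasFDerivAt
    exact h.comp_hasDerivAt (0 : ℝ) hγ
  exact h1.unique (hasDerivAt_proj_one_add_smul X)

/-- **The derivative of the orbit map along `t ↦ sec p (1 + tX)`**: by the affine action of the
section (`proj_sec_mul`) it is `(r (X₀₁ + X̄₁₀), r (Re X₀₀ − Re X₁₁))`, `p = (z, r)`.
[cite: Garrett2018, §1.6] -/
theorem hasDerivAt_proj_sec_mul_one_add_smul {p : ℂ × ℝ} (hp : 0 < p.2) (X : Mat) :
    HasDerivAt (fun t : ℝ => proj (sec p * ((1 : Mat) + t • X)))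
      ((p.2 : ℂ) * (tangentMap X).1, p.2 * (tangentMap X).2) 0 := by
  -- the affine map `A_p (z', r') = (r z' + z, r r')`
  have hA : HasDerivAt (fun t : ℝ => ((p.2 : ℂ) * (proj ((1 : Mat) + t • X)).1 + p.1,
      p.2 * (proj ((1 : Mat) + t • X)).2))
      ((p.2 : ℂ) * (tangentMap X).1, p.2 * (tangentMap X).2) 0 := by
    have h := hasDerivAt_proj_one_add_smul X
    have h1 : HasDerivAt (fun t : ℝ => (proj ((1 : Mat) + t • X)).1) (tangentMap X).1 0 :=
      (ContinuousLinearMap.fst ℝ ℂ ℝ).hasFDerivAt.comp_hasDerivAt (0 : ℝ) h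
    have h2 : HasDerivAt (fun t : ℝ => (proj ((1 : Mat) + t • X)).2) (tangentMap X).2 0 :=
      (ContinuousLinearMap.snd ℝ ℂ ℝ).hasFDerivAt.comp_hasDerivAt (0 : ℝ) h
    have hz := (h1.const_mul (p.2 : ℂ)).add_const p.1
    have hr := h2.const_mul p.2
    exact hz.prodMk hr
  refine hA.congr_of_eventuallyEq ?_
  have hc : Continuous fun t : ℝ => (1 : Mat) + t • X := by fun_prop
  have h1 : (1 : Mat) + (0 : ℝ) • X ∈ Inv := by simp
  filter_upwards [hc.continuousAt.preimage_mem_nhds (isOpen_Inv.mem_nhds h1)] with t ht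
  exact proj_sec_mul hp ht

end GL2C

end Literature.NumberTheory.Automorphic

end
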